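import Literature.Geometry.Hyperkaehler.AutomorphismsLocalSystemFixedPoints
import Literature.Geometry.Kaehler.FibrePropertyConnectedBase
import Literature.Geometry.Kaehler.FibreCohomologyTransport
import HarnessLib

/-!
# `Aut°`-equivariant identification of the cohomology of the fibres of a family of irreducible symplectic manifolds (Hassett–Tschinkel 2013 Thm. 2.1 + Ehresmann; PROVED from the fact)

Layer `Literature/Geometry/Hyperkaehler`.  Cell `hodge-kum4` (ladder HodgeAV, rung H3), tranche LT-H3,
director-hodge g7 2026-08-27T06:36:46Z item (4): the THEOREM flavour of the transport input `T₄`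
(«`H*(X; ℂ) ≅ H*(K⁴(A); ℂ)` as graded algebras, `Γ`-equivariantly») for ONE family, from the landed
analytic engine and Ehresmann's theorem (PROVED in the tree), modulo the single named fact
`HassettTschinkel2013_holAutZero_localSystem` taken as a hypothesis `h` (as in `nonempty_mulEquiv`,
`forall_orderOf_ncard_fixedPoints_iff`):

* **`HassettTschinkel2013_holAutZero_localSystem.exists_homeomorph_mulEquiv_cohomology`** — along a
  proper holomorphic submersion `π : 𝒳 → B` of irreducible symplectic manifolds over a connected base
  (`𝒳`, `B` Hausdorff, second countable), any two fibres `X ≅ 𝒳_s`, `Y ≅ 𝒳_t` admit a HOMEOMORPHISM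
  `m : X ≃ₜ Y` (Kodaira Thm. 2.3) and a group isomorphism `θ : Aut°(X) ≃* Aut°(Y)` (Hassett–Tschinkel
  Thm. 2.1: the stalks of the local system `Aut°(𝒳/B)`) such that `m^*` is `θ`-EQUIVARIANT on
  singular cohomology: `m^* ((θ g)^* c) = g^* (m^* c)` for all `g ∈ Aut°(X)`, all degrees and all
  coefficient rings (Voisin I §9.2.1; Oguiso 2020 §4: "`g_t^*` is derived from the action of `g̃` on
  the constant system `⊕ R^k u_* ℤ`");
* `….exists_homeomorph_mulEquiv_cohomology_of_family` — chain-step form whose hypothesis is the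
  ∃-body of `Geometry.Kaehler.IsDeformationOf X Y` ∧ an irreducible symplectic identification at every
  point of the base (the cell's located «IHS-chain» hypothesis, cf.
  `forall_orderOf_ncard_fixedPoints_iff_of_family`).

Proof: the property `P_X(Z) := ∃ (m : X ≃ₜ Z) (θ : Aut°(X) ≃* Aut°(Z)), m^* θ-equivariant` of a fibre
`Z` is LOCALLY CONSTANT over the base — near `b₀` the fact's fibrewise action `Φ` on `π⁻¹(U)` and
Ehresmann (`IsProperHolomorphicSubmersion.exists_nhds_fibreHomeomorph_cohomology`, file
`Kaehler/FibreCohomologyTransport`) give an equivariant pair `(m₀, e) : X₀ → Z` for every fibre `Z`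
over a smaller `V ∋ b₀` (`e` = the restriction isomorphism `exists_mulEquiv_of_restriction`), and
equivariant pairs compose and invert — hence constant over the connected base
(`Kaehler.fibreProp_iff_of_locally_iff`), and `P_X(X)` holds.  Everything is proved; no named fact,
no definition, no instance, no notation; nothing here asserts HC / HC_Kum4Type / `T₄` for all
`Kum⁴`-type varieties (that needs the chain over `IsDeformationEquivalent` under the IHS-chain
hypothesis and the algebraic ends — file `AlgebraicGeometry/Hyperkaehler/GeneralizedKummerTypeCohomologyTransport`
records the unconditional statement as a PRINT-SYNTHESIS fact).

References: B. Hassett, Yu. Tschinkel, Mosc. Math. J. 13 (2013) §2 Thm. 2.1 [`HassettTschinkel2013`];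
K. Kodaira (2005) §2.3 Thm. 2.3/2.5 [`Kodaira2005`]; C. Voisin (2002) §9.1.1 Thm. 9.3, §9.2.1
[`VoisinHodgeI2002`]; K. Oguiso, Nagoya Math. J. 239 (2020) §4 [`Oguiso2020CohomologicallyTrivialKummer`].
-/

noncomputable section

open scoped Manifold ContDiff Topology
open Function Set Filter
open Literature.Geometry.Kaehler
open Literature.AlgebraicTopology.SingularHomology

universe u v

namespace Literature.Geometry.Hyperkaehler

/-! ### Equivariant pairs `(m, θ)` invert and compose (plumbing on homeomorphism groups) -/

section Pairs

variable {X Y Z : Type u} [TopologicalSpace X] [TopologicalSpace Y] [TopologicalSpace Z]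
  {A : Subgroup (X ≃ₜ X)} {A' : Subgroup (Y ≃ₜ Y)} {A'' : Subgroup (Z ≃ₜ Z)}
  (R : Type v) [CommRing R]

/-- **Equivariant pairs invert**: if `m^* ∘ (θ g)^* = g^* ∘ m^*` for all `g ∈ A`, then
`(m⁻¹)^* ∘ (θ⁻¹ g')^* = g'^* ∘ (m⁻¹)^*` for all `g' ∈ A'`. [cite: HassettTschinkel2013, §2 Thm. 2.1] -/
theorem equivariantPair_symm (m : X ≃ₜ Y) (θ : A ≃* A')
    (hm : ∀ (g : A) (k : ℕ) (c : singularCohomology R R Y k),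
      singularCohomology.map R R (m : C(X, Y)) k
          (singularCohomology.map R R ((θ g : Y ≃ₜ Y) : C(Y, Y)) k c) =
        singularCohomology.map R R ((g : X ≃ₜ X) : C(X, X)) k
          (singularCohomology.map R R (m : C(X, Y)) k c))
    (g' : A') (k : ℕ) (c : singularCohomology R R X k) :
    singularCohomology.map R R (m.symm : C(Y, X)) k
        (singularCohomology.map R R ((θ.symm g' : X ≃ₜ X) : C(X, X)) k c) =
      singularCohomology.map R R ((g' : Y ≃ₜ Y) : C(Y, Y)) k
        (singularCohomology.map R R (m.symm : C(Y, X)) k c) := by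
  -- `m^* (m⁻¹)^* = id`, `(m⁻¹)^* m^* = id` (the tree's `singularCohomology.mapIso`; cf.
  -- `singularCohomology.map_map_symm` / `map_symm_map` of `HodgeTheory/MotivatedClassesTransport`, not
  -- imported into this analytic layer)
  have h1 : ∀ a : singularCohomology R R X k, singularCohomology.map R R (m : C(X, Y)) k
      (singularCohomology.map R R (m.symm : C(Y, X)) k a) = a := fun a ↦ by
    rw [← singularCohomology.mapIso_hom, ← singularCohomology.mapIso_inv, ← ModuleCat.comp_apply,
      CategoryTheory.Iso.inv_hom_id, ModuleCat.id_apply]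
  have h2 : ∀ a : singularCohomology R R Y k, singularCohomology.map R R (m.symm : C(Y, X)) k
      (singularCohomology.map R R (m : C(X, Y)) k a) = a := fun a ↦ by
    rw [← singularCohomology.mapIso_inv, ← singularCohomology.mapIso_hom, ← ModuleCat.comp_apply,
      CategoryTheory.Iso.hom_inv_id, ModuleCat.id_apply]
  have h := hm (θ.symm g') k (singularCohomology.map R R (m.symm : C(Y, X)) k c)
  rw [MulEquiv.apply_symm_apply, h1] at h
  -- `h : m^* (g'^* (m⁻¹)^* c) = (θ⁻¹ g')^* c`; apply `(m⁻¹)^*`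
  have h' := congrArg (singularCohomology.map R R (m.symm : C(Y, X)) k) h
  rw [h2] at h'
  exact h'.symm

/-- **Equivariant pairs compose.** [cite: HassettTschinkel2013, §2 Thm. 2.1] -/
theorem equivariantPair_trans (m : X ≃ₜ Y) (θ : A ≃* A') (m' : Y ≃ₜ Z) (θ' : A' ≃* A'')
    (hm : ∀ (g : A) (k : ℕ) (c : singularCohomology R R Y k),
      singularCohomology.map R R (m : C(X, Y)) k
          (singularCohomology.map R R ((θ g : Y ≃ₜ Y) : C(Y, Y)) k c) =
        singularCohomology.map R R ((g : X ≃ₜ X) : C(X, X)) k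
          (singularCohomology.map R R (m : C(X, Y)) k c))
    (hm' : ∀ (g' : A') (k : ℕ) (c : singularCohomology R R Z k),
      singularCohomology.map R R (m' : C(Y, Z)) k
          (singularCohomology.map R R ((θ' g' : Z ≃ₜ Z) : C(Z, Z)) k c) =
        singularCohomology.map R R ((g' : Y ≃ₜ Y) : C(Y, Y)) k
          (singularCohomology.map R R (m' : C(Y, Z)) k c))
    (g : A) (k : ℕ) (c : singularCohomology R R Z k) :
    singularCohomology.map R R ((m.trans m' : X ≃ₜ Z) : C(X, Z)) k
        (singularCohomology.map R R ((θ.trans θ' g : Z ≃ₜ Z) : C(Z, Z)) k c) =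
      singularCohomology.map R R ((g : X ≃ₜ X) : C(X, X)) k
        (singularCohomology.map R R ((m.trans m' : X ≃ₜ Z) : C(X, Z)) k c) := by
  have hcomp : ((m.trans m' : X ≃ₜ Z) : C(X, Z)) = (m' : C(Y, Z)).comp (m : C(X, Y)) := by
    ext x; rfl
  rw [hcomp, singularCohomology.map_comp, ModuleCat.comp_apply, ModuleCat.comp_apply,
    MulEquiv.trans_apply, hm', hm]

/-- The identity pair is equivariant. [cite: HassettTschinkel2013, §2 Thm. 2.1] -/
theorem equivariantPair_refl (g : A) (k : ℕ) (c : singularCohomology R R X k) :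
    singularCohomology.map R R ((Homeomorph.refl X : X ≃ₜ X) : C(X, X)) k
        (singularCohomology.map R R ((MulEquiv.refl A g : X ≃ₜ X) : C(X, X)) k c) =
      singularCohomology.map R R ((g : X ≃ₜ X) : C(X, X)) k
        (singularCohomology.map R R ((Homeomorph.refl X : X ≃ₜ X) : C(X, X)) k c) := by
  have h : ((Homeomorph.refl X : X ≃ₜ X) : C(X, X)) = ContinuousMap.id X := by ext x; rfl
  rw [h, singularCohomology.map_id, ModuleCat.id_apply, ModuleCat.id_apply, MulEquiv.refl_apply]

end Pairs

/-! ### The one-family statement -/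

section Family

variable {E𝒳 : Type u} [NormedAddCommGroup E𝒳] [NormedSpace ℂ E𝒳] [FiniteDimensional ℂ E𝒳]
  {𝒳 : Type u} [TopologicalSpace 𝒳] [ChartedSpace E𝒳 𝒳] [IsManifold 𝓘(ℂ, E𝒳) ω 𝒳]
  [T2Space 𝒳] [SecondCountableTopology 𝒳]
  {EB : Type u} [NormedAddCommGroup EB] [NormedSpace ℂ EB] [FiniteDimensional ℂ EB]
  {B : Type u} [TopologicalSpace B] [ChartedSpace EB B] [IsManifold 𝓘(ℂ, EB) ω B]
  [T2Space B] [SecondCountableTopology B] [ConnectedSpace B]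
  {π : 𝒳 → B}

/-- **Along ONE family of irreducible symplectic manifolds, any two fibres have `Aut°`-equivariantly
identified cohomology** (Hassett–Tschinkel Thm. 2.1 + Ehresmann + the open-and-closed step; PROVED
from the fact): for fibres `X ≅ 𝒳_s`, `Y ≅ 𝒳_t` of a proper holomorphic submersion of irreducible
symplectic manifolds over a connected base there are a homeomorphism `m : X ≃ₜ Y` and a group
isomorphism `θ : Aut°(X) ≃* Aut°(Y)` with `m^* ((θ g)^* c) = g^* (m^* c)` for all `g ∈ Aut°(X)`,
`k`, `c ∈ Hᵏ(Y; R)`. [cite: HassettTschinkel2013, §2 Thm. 2.1] [cite: Kodaira2005, §2.3 Thm. 2.3]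
[cite: VoisinHodgeI2002, §9.2.1] [cite: Oguiso2020CohomologicallyTrivialKummer, §4 (proof of Thm. 1.3)] -/
theorem HassettTschinkel2013_holAutZero_localSystem.exists_homeomorph_mulEquiv_cohomology
    (h : HassettTschinkel2013_holAutZero_localSystem.{u})
    (hπ : IsProperHolomorphicSubmersion E𝒳 EB π)
    (hIHS : ∀ b : B, ∃ (X : ComplexManifold.{u}) (ι : X → 𝒳),
      IsFibreEmbedding X.model E𝒳 π b ι ∧ X.IsIrreducibleSymplectic)
    {s t : B} {X Y : ComplexManifold.{u}} {ι : X → 𝒳} {κ : Y → 𝒳}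
    (hι : IsFibreEmbedding X.model E𝒳 π s ι) (hκ : IsFibreEmbedding Y.model E𝒳 π t κ)
    (R : Type v) [CommRing R] :
    ∃ (m : X ≃ₜ Y) (θ : holAutZero X.model X ≃* holAutZero Y.model Y),
      ∀ (g : holAutZero X.model X) (k : ℕ) (c : singularCohomology R R Y k),
        singularCohomology.map R R (m : C(X, Y)) k
            (singularCohomology.map R R ((θ g : Y ≃ₜ Y) : C(Y, Y)) k c) =
          singularCohomology.map R R ((g : X ≃ₜ X) : C(X, X)) k
            (singularCohomology.map R R (m : C(X, Y)) k c) := by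
  classical
  -- the fibre property: an equivariant pair from `X`
  let P : ComplexManifold.{u} → Prop := fun Z =>
    ∃ (m : X ≃ₜ Z) (θ : holAutZero X.model X ≃* holAutZero Z.model Z),
      ∀ (g : holAutZero X.model X) (k : ℕ) (c : singularCohomology R R Z k),
        singularCohomology.map R R (m : C(X, Z)) k
            (singularCohomology.map R R ((θ g : Z ≃ₜ Z) : C(Z, Z)) k c) =
          singularCohomology.map R R ((g : X ≃ₜ X) : C(X, X)) k
            (singularCohomology.map R R (m : C(X, Z)) k c)
  have hfib : ∀ b : B, ∃ (Z : ComplexManifold.{u}) (μ : Z → 𝒳), IsFibreEmbedding Z.model E𝒳 π b μ :=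
    fun b => by
      obtain ⟨Z, μ, hμ, -⟩ := hIHS b
      exact ⟨Z, μ, hμ⟩
  -- local constancy of `P`: near `b₀`, every fibre `Z` receives an equivariant pair from `X₀`
  have hloc : ∀ (b₀ : B) (X₀ : ComplexManifold.{u}) (ι₀ : X₀ → 𝒳),
      IsFibreEmbedding X₀.model E𝒳 π b₀ ι₀ →
        ∃ U : Set B, IsOpen U ∧ b₀ ∈ U ∧
          ∀ b ∈ U, ∀ (Z : ComplexManifold.{u}) (μ : Z → 𝒳),
            IsFibreEmbedding Z.model E𝒳 π b μ → (P Z ↔ P X₀) := by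
    intro b₀ X₀ ι₀ hι₀
    obtain ⟨U, hUo, -, hb₀U, Φ, hsec, hmul, -, hfibre⟩ := h hπ hIHS b₀ X₀ ι₀ hι₀
    obtain ⟨V, hVo, hb₀V, hVU, hV⟩ := hπ.exists_nhds_fibreHomeomorph_cohomology hUo hb₀U
      hι₀.isClosedEmbedding hι₀.range_eq
    refine ⟨V, hVo, hb₀V, fun b hb Z μ hμ => ?_⟩
    -- the equivariant pair `(m₀, e) : X₀ → Z`
    obtain ⟨m₀, hm₀⟩ := hV b hb hμ.isClosedEmbedding hμ.range_eq
    obtain ⟨hres, huniq⟩ := hfibre b (hVU hb) Z μ hμ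
    obtain ⟨e, he⟩ := exists_mulEquiv_of_restriction (holAutZero X₀.model X₀) (holAutZero Z.model Z)
      Φ μ hμ.isClosedEmbedding.injective (π ⁻¹' U)
      (fun z => show π (μ z) ∈ U by rw [hμ.apply_eq]; exact hVU hb) hmul hres huniq
    have pair₀ : ∀ (g : holAutZero X₀.model X₀) (k : ℕ) (c : singularCohomology R R Z k),
        singularCohomology.map R R (m₀ : C(X₀, Z)) k
            (singularCohomology.map R R ((e g : Z ≃ₜ Z) : C(Z, Z)) k c) =
          singularCohomology.map R R ((g : X₀ ≃ₜ X₀) : C(X₀, X₀)) k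
            (singularCohomology.map R R (m₀ : C(X₀, Z)) k c) := by
      intro g k c
      obtain ⟨hΦc, hΦπ, hΦι₀⟩ := hsec (g : X₀ ≃ₜ X₀) g.2
      exact hm₀ (Φ (g : X₀ ≃ₜ X₀)) (hΦc.continuousOn.mono (preimage_mono hVU))
        (fun y hy => hΦπ y (preimage_mono hVU hy)) ((g : X₀ ≃ₜ X₀) : C(X₀, X₀))
        ((e g : Z ≃ₜ Z) : C(Z, Z)) (fun x => hΦι₀ x) (fun z => he g z) R k c
    constructor
    · -- `P Z → P X₀`: compose with the inverse pair `Z → X₀`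
      rintro ⟨m, θ, hmθ⟩
      exact ⟨m.trans m₀.symm, θ.trans e.symm,
        equivariantPair_trans R m θ m₀.symm e.symm hmθ (equivariantPair_symm R m₀ e pair₀)⟩
    · -- `P X₀ → P Z`: compose with the pair `X₀ → Z`
      rintro ⟨m, θ, hmθ⟩
      exact ⟨m.trans m₀, θ.trans e, equivariantPair_trans R m θ m₀ e hmθ pair₀⟩
  -- `P X` holds (identity pair); conclude over the connected base
  have hX : P X := ⟨Homeomorph.refl X, MulEquiv.refl _, equivariantPair_refl R⟩
  exact (fibreProp_iff_of_locally_iff hfib P hloc hι hκ).1 hX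

/-- **Chain-step form** (hypothesis = the ∃-body of `Geometry.Kaehler.IsDeformationOf X Y` together
with an irreducible symplectic fibre identification at every point of the base — the cell's located
«IHS-chain» hypothesis; cf. `forall_orderOf_ncard_fixedPoints_iff_of_family`): if `Y` is a
deformation of `X` through a family of irreducible symplectic manifolds, then there are `m : X ≃ₜ Y`
and `θ : Aut°(X) ≃* Aut°(Y)` with `m^*` `θ`-equivariant on `Hᵏ(·; R)`.
[cite: HassettTschinkel2013, §2 Thm. 2.1] [cite: Kodaira2005, §2.3 Def. 2.9 and Thm. 2.3] -/
theorem HassettTschinkel2013_holAutZero_localSystem.exists_homeomorph_mulEquiv_cohomology_of_family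
    (h : HassettTschinkel2013_holAutZero_localSystem.{u}) {X Y : ComplexManifold.{u}}
    (hXY : ∃ (𝒴 C : ComplexManifold.{u}) (ϖ : 𝒴 → C) (s t : C) (ι : X → 𝒴) (κ : Y → 𝒴),
      T2Space 𝒴 ∧ SecondCountableTopology 𝒴 ∧ T2Space C ∧ SecondCountableTopology C ∧
        ConnectedSpace C ∧ IsProperHolomorphicSubmersion 𝒴.model C.model ϖ ∧
        IsFibreEmbedding X.model 𝒴.model ϖ s ι ∧ IsFibreEmbedding Y.model 𝒴.model ϖ t κ ∧
        ∀ c : C, ∃ (Z : ComplexManifold.{u}) (μ : Z → 𝒴),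
          IsFibreEmbedding Z.model 𝒴.model ϖ c μ ∧ Z.IsIrreducibleSymplectic)
    (R : Type v) [CommRing R] :
    ∃ (m : X ≃ₜ Y) (θ : holAutZero X.model X ≃* holAutZero Y.model Y),
      ∀ (g : holAutZero X.model X) (k : ℕ) (c : singularCohomology R R Y k),
        singularCohomology.map R R (m : C(X, Y)) k
            (singularCohomology.map R R ((θ g : Y ≃ₜ Y) : C(Y, Y)) k c) =
          singularCohomology.map R R ((g : X ≃ₜ X) : C(X, X)) k
            (singularCohomology.map R R (m : C(X, Y)) k c) := by
  obtain ⟨𝒴, C, ϖ, s, t, ι, κ, h𝒴T2, h𝒴SC, hCT2, hCSC, hCconn, hϖ, hι, hκ, hIHS⟩ := hXY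
  haveI := h𝒴T2; haveI := h𝒴SC; haveI := hCT2; haveI := hCSC; haveI := hCconn
  exact h.exists_homeomorph_mulEquiv_cohomology hϖ hIHS hι hκ R

end Family

end Literature.Geometry.Hyperkaehler

end
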